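import Literature.Algebra.Homology.ContCohomologyTransgression
import Literature.AnabelianGeometry.AbsoluteAnabelian.AbsTopIII.CuspidallyCentralExtension
import Literature.AnabelianGeometry.AbsoluteAnabelian.AbsTopIII.GeometricCyclotome
import HarnessLib

/-!
# [AbsTopIII] Prop. 1.4 (ii): the transgression `Hom(M_X, Λ) → H²(Δ_X, Λ)` of `1 → M_X → Δ^{c-cn}_{U_x} → Δ_X → 1`

Mochizuki, *Topics in Absolute Anabelian Geometry III*, §1, Prop. 1.4 (ii), manuscript pp. 31–32
(lit key `paper:url-5493eb38cbb7`), verbatim: "Then we have a natural exact sequence of profinite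
groups `1 → I_x → Δ^{c-cn}_{U_x} → Δ_X → 1` [...]. Moreover, applying the differential of the
“`E_2`-term” of the Leray spectral sequence associated to this group extension to the element
`1 ∈ Ẑ = Hom(I_x, I_x) = H^0(Δ_X, H^1(I_x, I_x))` yields an element `∈ H^2(Δ_X, H^0(I_x, I_x)) =
Hom(M_X, I_x)`, where we write `M_X := Hom(H^2(Δ_X, Ẑ), Ẑ)` [...]; this last element corresponds to
the natural isomorphism `M_X ⥲ I_x`" (p. 31 l. 38–56, p. 32 l. 1–5).

OUR READING (not a quotation): the "differential of the `E_2`-term" is the transgression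
`d : Hom_cont(I_x, Λ) → H^2(Δ_X, Λ)` of the central extension with (trivial) coefficients `Λ`; the text
applies it with `Λ = I_x` to `1 = id`; we type it for arbitrary `Λ` and record the content of "this last
element corresponds to the natural isomorphism `M_X ⥲ I_x`" as the map-level statement that `d` is
BIJECTIVE for `Λ = Ẑ` (equivalent, for `I_x ≅ Ẑ`, via the rank-one generator).

With abc-iut-L4-t16's generic transgression of a topological central extension
(`ContinuousCohomology.transgression`, `ContCohomologyTransgression.lean`: factor set of a continuous
lift, class in Mathlib's continuous `H²`, independence of the lift, naturality) and the central
extension `deltaCcnProj q : Δ^{c-cn}_{U_x} ↠ Δ_X` with kernel `M_X` (`CuspidallyCentralExtension.lean`),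
this file makes the DIFFERENTIAL OF PROP. 1.4 (ii) A REAL MAP:

* `deltaCcnProjₜ q` (as a `→ₜ*`), `deltaCcn_central` (its kernel is central);
* `CcnSection q` — a continuous set-theoretic section of `Δ^{c-cn}_{U_x} ↠ Δ_X` (datum; such sections
  exist for profinite quotients, cf. the tree's `ProfiniteCrossSection.lean` — not wired here);
* `ccnTransgression q s Λ : (Additive M_X^{c-cn} →ₜ+ Λ) →+ H²(Δ_X, Λ)` (`geomH2`, trivial
  coefficients), INDEPENDENT of `s` (`ccnTransgression_eq`);
* the statement of Prop. 1.4 (ii) as a property of this NAMED map: `CurveModel.Prop_1_4_ii_transgression`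
  (OUR map-level reading of "this last element corresponds to the natural isomorphism `M_X ⥲ I_x`",
  not a quotation) — for every cyclotome presentation of the model and `Λ = Ẑ`, `ccnTransgression`
  is bijective.  NAMED FACT relative to `M` (it supersedes the `∃`-shaped `Prop_1_4_ii_sync` as the
  faithful form of "natural isomorphism").

HONEST FRAMING: typed ≠ discharged; nothing here bears on [IUTchIII] Cor. 3.12.
-/

noncomputable section

open CategoryTheory

universe u

namespace Literature.AnabelianGeometry.AbsoluteAnabelian.AbsTopIII

variable {E F : FundamentalExtension.{u}} (q : E ⟶ F)

/-- `Δ^{c-cn}_{U_x} ↠ Δ_X` as a continuous homomorphism. [cite: MochizukiAbsTopIII2015, Prop 1.4 (ii) p.31] -/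
def deltaCcnProjₜ : DeltaCcn q →ₜ* F.geom where
  toMonoidHom := deltaCcnProj q
  continuous_toFun := continuous_deltaCcnProj q

/-- `deltaCcnProjₜ` is `deltaCcnProj`. [cite: MochizukiAbsTopIII2015, Prop 1.4 (ii) p.31] -/
@[simp] theorem deltaCcnProjₜ_apply (y : DeltaCcn q) : deltaCcnProjₜ q y = deltaCcnProj q y := rfl

/-- The kernel of `Δ^{c-cn}_{U_x} ↠ Δ_X` (abc-iut-L4-t16's `extKer`) is `M_X`.
[cite: MochizukiAbsTopIII2015, Prop 1.4 (ii) p.31] -/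
theorem extKer_deltaCcnProjₜ :
    ContinuousCohomology.extKer (deltaCcnProjₜ q) = (geomCyclotome q).subgroupOf (DeltaCcn q) :=
  ker_deltaCcnProj q

/-- The kernel of `Δ^{c-cn}_{U_x} ↠ Δ_X` is CENTRAL. [cite: MochizukiAbsTopIII2015, Prop 1.4 (ii) p.31] -/
theorem deltaCcn_central :
    ∀ a ∈ ContinuousCohomology.extKer (deltaCcnProjₜ q), ∀ e : DeltaCcn q, e * a = a * e := by
  intro a ha e
  rw [extKer_deltaCcnProjₜ, Subgroup.mem_subgroupOf] at ha
  exact Subtype.ext (geomCyclotome_mul_comm q ha e.2).symm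

/-- A continuous set-theoretic SECTION of `Δ^{c-cn}_{U_x} ↠ Δ_X` (datum for the factor set; such
sections exist for quotients of profinite groups — `ProfiniteCrossSection.lean` of the trunk — and the
transgression does not depend on the choice, `ccnTransgression_eq`).
[cite: MochizukiAbsTopIII2015, Prop 1.4 (ii) p.31] -/
structure CcnSection (q : E ⟶ F) : Type u where
  /-- the section as a continuous map `Δ_X → Δ^{c-cn}_{U_x}` -/
  toFun : C(F.geom, DeltaCcn q)
  /-- it is a section of `deltaCcnProj` -/
  proj_apply : ∀ d, deltaCcnProjₜ q (toFun d) = d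

variable (Λ : Type u) [AddCommGroup Λ] [TopologicalSpace Λ] [IsTopologicalAddGroup Λ]

/-- **The differential of Prop. 1.4 (ii)**: the transgression
`Hom_cont(M_X, Λ) → H²(Δ_X, Λ)` of the central extension `1 → M_X → Δ^{c-cn}_{U_x} → Δ_X → 1`,
`χ ↦ [χ ∘ c_s]` for the factor set `c_s` of a continuous section `s`
(abc-iut-L4-t16's `ContinuousCohomology.transgression`; the codomain is `geomH2 F Λ = H²(Δ_X, Λ)`,
Mathlib's continuous cohomology with trivial coefficients).
[cite: MochizukiAbsTopIII2015, Prop 1.4 (ii) p.31] -/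
def ccnTransgression (s : CcnSection q) :
    (Additive (ContinuousCohomology.extKer (deltaCcnProjₜ q)) →ₜ+ Λ) →+ geomH2 F Λ :=
  ContinuousCohomology.transgression (deltaCcnProjₜ q) (ContinuousMonoidHom.id F.geom) s.toFun
    (fun d => s.proj_apply d) (deltaCcn_central q)

/-- **The transgression is natural**: it does not depend on the section.
[cite: MochizukiAbsTopIII2015, Prop 1.4 (ii) p.31] -/
theorem ccnTransgression_eq (s s' : CcnSection q) :
    ccnTransgression q Λ s = ccnTransgression q Λ s' :=
  AddMonoidHom.ext fun χ =>
    ContinuousCohomology.transgression_liftChange (deltaCcnProjₜ q) (ContinuousMonoidHom.id F.geom)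
      s'.toFun (fun d => s'.proj_apply d) (deltaCcn_central q) s.toFun (fun d => s.proj_apply d) χ

/-! ### The natural synchronization `M_X^{c-cn} → M_X = Hom(H²(Δ_X, Ẑ), Ẑ)` determined by the differential -/

/-- Evaluation of continuous homomorphisms `Ker → Ẑ` at an element of the kernel.
[cite: MochizukiAbsTopIII2015, Prop 1.4 (ii) p.32] -/
def evalAtKer (i : Additive (ContinuousCohomology.extKer (deltaCcnProjₜ q))) :
    (Additive (ContinuousCohomology.extKer (deltaCcnProjₜ q)) →ₜ+ ZHatCoeff.{u}) →+ ZHatCoeff.{u} where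
  toFun χ := χ i
  map_zero' := rfl
  map_add' _ _ := rfl

/-- When the differential `d : Hom_cont(Ker, Ẑ) → H²(Δ_X, Ẑ)` is bijective (Prop. 1.4 (ii)), **the
natural synchronization** `Ker(Δ^{c-cn}_{U_x} ↠ Δ_X) → M_X := Hom(H²(Δ_X, Ẑ), Ẑ)`,
`i ↦ (ξ ↦ (d⁻¹ ξ)(i))` — "this last element corresponds to the natural isomorphism `M_X ⥲ I_x`"
(p. 32), here in the direction `I_x ≅ Ker → M_X` and phrased through `d⁻¹` and evaluation (no choice
of generator).  Defined relative to a section `s` and a bijectivity witness; independent of `s`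
(`synchronizationOfBijective_eq`). [cite: MochizukiAbsTopIII2015, Prop 1.4 (ii) p.32] -/
def synchronizationOfBijective (s : CcnSection q)
    (hd : Function.Bijective (ccnTransgression q ZHatCoeff.{u} s)) :
    Additive (ContinuousCohomology.extKer (deltaCcnProjₜ q)) →+ geomCyclotomeDual F ZHatCoeff.{u} where
  toFun i :=
    { toFun := fun ξ => (AddEquiv.ofBijective _ hd).symm ξ i
      map_add' := fun ξ η => by rw [map_add]; rfl
      map_smul' := fun c ξ => by
        have h := map_intCast_smul
          ((evalAtKer q i).comp (AddEquiv.ofBijective _ hd).symm.toAddMonoidHom) ℤ ℤ c ξ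
        simpa [evalAtKer] using h }
  map_zero' := by
    apply LinearMap.ext
    intro ξ
    change (AddEquiv.ofBijective _ hd).symm ξ 0 = 0
    exact map_zero _
  map_add' i j := by
    apply LinearMap.ext
    intro ξ
    change (AddEquiv.ofBijective _ hd).symm ξ (i + j) =
      (AddEquiv.ofBijective _ hd).symm ξ i + (AddEquiv.ofBijective _ hd).symm ξ j
    exact map_add _ i j

/-- Formula for the synchronization. [cite: MochizukiAbsTopIII2015, Prop 1.4 (ii) p.32] -/
theorem synchronizationOfBijective_apply (s : CcnSection q)
    (hd : Function.Bijective (ccnTransgression q ZHatCoeff.{u} s))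
    (i : Additive (ContinuousCohomology.extKer (deltaCcnProjₜ q))) (ξ : geomH2 F ZHatCoeff.{u}) :
    synchronizationOfBijective q s hd i ξ = (AddEquiv.ofBijective _ hd).symm ξ i :=
  rfl

/-- Defining property: `d (χ) = ξ ⇒ sync(i)(ξ) = χ(i)`. [cite: MochizukiAbsTopIII2015, Prop 1.4 (ii) p.32] -/
theorem synchronizationOfBijective_apply_transgression (s : CcnSection q)
    (hd : Function.Bijective (ccnTransgression q ZHatCoeff.{u} s))
    (i : Additive (ContinuousCohomology.extKer (deltaCcnProjₜ q)))
    (χ : Additive (ContinuousCohomology.extKer (deltaCcnProjₜ q)) →ₜ+ ZHatCoeff.{u}) :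
    synchronizationOfBijective q s hd i (ccnTransgression q ZHatCoeff.{u} s χ) = χ i := by
  rw [synchronizationOfBijective_apply]
  have : (AddEquiv.ofBijective _ hd).symm (ccnTransgression q ZHatCoeff.{u} s χ) = χ :=
    (AddEquiv.ofBijective _ hd).injective (by simp)
  rw [this]

/-- **Naturality**: the synchronization does not depend on the section.
[cite: MochizukiAbsTopIII2015, Prop 1.4 (ii) p.32] -/
theorem synchronizationOfBijective_eq (s s' : CcnSection q)
    (hd : Function.Bijective (ccnTransgression q ZHatCoeff.{u} s))
    (hd' : Function.Bijective (ccnTransgression q ZHatCoeff.{u} s')) :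
    synchronizationOfBijective q s hd = synchronizationOfBijective q s' hd' := by
  apply AddMonoidHom.ext
  intro i
  apply LinearMap.ext
  intro ξ
  rw [synchronizationOfBijective_apply, synchronizationOfBijective_apply]
  congr 1
  apply hd.1
  conv_rhs => rw [ccnTransgression_eq q ZHatCoeff.{u} s s']
  change (AddEquiv.ofBijective _ hd) ((AddEquiv.ofBijective _ hd).symm ξ) =
    (AddEquiv.ofBijective _ hd') ((AddEquiv.ofBijective _ hd').symm ξ)
  rw [AddEquiv.apply_symm_apply, AddEquiv.apply_symm_apply]

namespace CurveModel

/-- **Prop. 1.4 (ii), second half, as a property of the NAMED differential, relative to `M`**.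
Print (p. 31 l. 47–56, verbatim): "applying the differential of the “`E_2`-term” of the Leray
spectral sequence associated to this group extension to the element `1 ∈ Ẑ = Hom(I_x, I_x) =
H^0(Δ_X, H^1(I_x, I_x))` yields an element `∈ H^2(Δ_X, H^0(I_x, I_x)) = Hom(M_X, I_x)` [...]; this last
element corresponds to the natural isomorphism `M_X ⥲ I_x`".  OUR map-level rendering (not a
quotation; equivalent for `I_x ≅ Ẑ` via the rank-one generator): for every cyclotome presentation
`(U_x ⊆ X, x)` of the model and every continuous section, the differential
`Hom_cont(Ker(Δ^{c-cn}_{U_x} ↠ Δ_X), Ẑ) → H^2(Δ_X, Ẑ)` (`ccnTransgression`, `Λ = Ẑ`) is BIJECTIVE.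
NAMED FACT relative to `M`. [cite: MochizukiAbsTopIII2015, Prop 1.4 (ii) p.31] -/
def Prop_1_4_ii_transgression (M : CurveModel.{u}) : Prop :=
  ∀ (Ux X : M.Curve) (h : M.IsCofiniteOpen Ux X) (x : (M.cusps Ux).Cusp),
    M.IsCyclotomePresentation h x → ∀ s : CcnSection (M.res h),
      Function.Bijective (ccnTransgression (M.res h) ZHatCoeff.{u} s)

end CurveModel

end Literature.AnabelianGeometry.AbsoluteAnabelian.AbsTopIII
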